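import Mathlib
import Summits.Ventures.DiscreteObjects.Mahler.CensusKernelDeg26Tables
import Summits.Ventures.DiscreteObjects.Mahler.CensusKernelDeg24Tables
import Summits.Ventures.DiscreteObjects.Mahler.AuxCut26L2Pos
import Summits.Ventures.DiscreteObjects.Mahler.AuxCut26L4Neg
import Summits.Ventures.DiscreteObjects.Mahler.AuxCut26L5Pos
import Summits.Ventures.DiscreteObjects.Mahler.AuxCut26L5Neg
import Summits.Ventures.DiscreteObjects.Mahler.AuxCut26L6Pos
import Summits.Ventures.DiscreteObjects.Mahler.AuxCut26L7Neg
import Summits.Ventures.DiscreteObjects.Mahler.AuxCut26L8Pos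
import Summits.Ventures.DiscreteObjects.Mahler.AuxCut26L8Neg
import Summits.Ventures.DiscreteObjects.Mahler.AuxCut26L9Pos
import Summits.Ventures.DiscreteObjects.Mahler.AuxCut26L9Neg
import Summits.Ventures.DiscreteObjects.Mahler.AuxCut26L11Pos
import Summits.Ventures.DiscreteObjects.Mahler.AuxCut26L11Neg
import Summits.Ventures.DiscreteObjects.Mahler.AuxCut26N12PosS1
import Summits.Ventures.DiscreteObjects.Mahler.AuxCut26N12PosS2
import Summits.Ventures.DiscreteObjects.Mahler.AuxCut26N12PosS3
import Summits.Ventures.DiscreteObjects.Mahler.AuxCut26N12PosS4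
import Summits.Ventures.DiscreteObjects.Mahler.AuxCut26N12PosS5
import Summits.Ventures.DiscreteObjects.Mahler.AuxCut26N12PosS6
import Summits.Ventures.DiscreteObjects.Mahler.AuxCut26N12PosS7
import Summits.Ventures.DiscreteObjects.Mahler.AuxCut26L12Neg
import Summits.Ventures.DiscreteObjects.Mahler.AuxCut26L13Pos
import Summits.Ventures.DiscreteObjects.Mahler.AuxCut26L13Neg
import Summits.Ventures.DiscreteObjects.Mahler.AuxCut26L15Pos
import Summits.Ventures.DiscreteObjects.Mahler.AuxCut26L15Neg
import Summits.Ventures.DiscreteObjects.Mahler.AuxCut26L17Pos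
import Summits.Ventures.DiscreteObjects.Mahler.AuxCut26L17Neg
import Summits.Ventures.DiscreteObjects.Mahler.AuxCut26L18Pos
import Summits.Ventures.DiscreteObjects.Mahler.AuxCut26L18Neg
import Summits.Ventures.DiscreteObjects.Mahler.AuxCut26L20Neg
import Summits.Ventures.DiscreteObjects.Mahler.AuxCut26L1Pos
import Summits.Ventures.DiscreteObjects.Mahler.AuxCut26L1Neg
import Summits.Ventures.DiscreteObjects.Mahler.AuxCut26K2Neg
import Summits.Ventures.DiscreteObjects.Mahler.AuxCut26L3Pos
import Summits.Ventures.DiscreteObjects.Mahler.AuxCut26L3Neg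
import Summits.Ventures.DiscreteObjects.Mahler.AuxCut26L4Pos
import Summits.Ventures.DiscreteObjects.Mahler.AuxCut26L6Neg
import Summits.Ventures.DiscreteObjects.Mahler.AuxCut26L7Pos
import Summits.Ventures.DiscreteObjects.Mahler.AuxCut26L10Pos
import Summits.Ventures.DiscreteObjects.Mahler.AuxCut26L10Neg
import Summits.Ventures.DiscreteObjects.Mahler.AuxCut26L20Pos
import Summits.Ventures.DiscreteObjects.Mahler.CensusKernelDeg26S02
import Summits.Ventures.DiscreteObjects.Mahler.CensusKernelDeg26S01
import Summits.Ventures.DiscreteObjects.Mahler.CensusKernelDeg26S03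
import Summits.Ventures.DiscreteObjects.Mahler.CensusKernelDeg26S04
import Summits.Ventures.DiscreteObjects.Mahler.CensusKernelDeg26S05
import Summits.Ventures.DiscreteObjects.Mahler.CensusKernelDeg26S06
import Summits.Ventures.DiscreteObjects.Mahler.CensusKernelDeg26S07
import Summits.Ventures.DiscreteObjects.Mahler.CensusKernelDeg26S08
import Summits.Ventures.DiscreteObjects.Mahler.CensusKernelDeg26S09
import Summits.Ventures.DiscreteObjects.Mahler.CensusKernelDeg26S10
import Summits.Ventures.DiscreteObjects.Mahler.CensusKernelDeg26S11
import Summits.Ventures.DiscreteObjects.Mahler.CensusKernelDeg26S12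
import Summits.Ventures.DiscreteObjects.Mahler.CensusKernelDeg26S13
import Summits.Ventures.DiscreteObjects.Mahler.CensusKernelDeg26S14
import Summits.Ventures.DiscreteObjects.Mahler.CensusKernelDeg26S15
import Summits.Ventures.DiscreteObjects.Mahler.CensusKernelDeg26S16
import Summits.Ventures.DiscreteObjects.Mahler.CensusKernelDeg26S17
import Summits.Ventures.DiscreteObjects.Mahler.CensusKernelDeg26S18
import Summits.Ventures.DiscreteObjects.Mahler.SubLehmerDegreeTwentyFour
import Summits.Ventures.DiscreteObjects.Mahler.CensusRows26Kernel
import Summits.Ventures.DiscreteObjects.Mahler.CensusListedLehmerMinimum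

/-!
# Degree-26 kernel census at the Lehmer bound `B = 20/17`: validity, assembly, and Lehmer's bound for irreducible polynomials of degree 26/27 (venture `DiscreteObjects`, target L)

Cell `pub-namedobj`, seats `pub-namedobj-mahler-g19`/`g20` (census, packed search, certificates), `g21` (subtree files, star
certificates), `g22` (merged assembly), `g26` (this merged file: the former part `CensusKernelDeg26A` — validity of the thresholds and of
the combined cut table — and the assembly `CensusKernelDeg26Final` in ONE module; eleven of the twelve star-certified cuts are now
imported from their landed chain certificates `AuxCut26L…/K2Neg` — which is what bounced p379255/p389740 on dedup — and only
`AuxCut26N12Pos.cutValid` is still composed here from its seven landed segment files; texts of the statements unchanged).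
Framing: lottery ticket; floor = certified bounds/negative ranges.

PART A (validity).  `DegreeCensus 26 (20/17) coresDeg26` is a THEOREM of the Lean kernel (standard axioms; `decide` with kernel
reduction, no `native_decide`).  The statements are about the census search `censusSearchC` (mahler g12/g13) with a COMBINED cut table —
the few Fejér–Riesz / RESULTANT cuts (`CT26tr`, mahler g13/g14) that ever bind in the degree-26 tree AND the kernel-certified
EXPLICIT-AUXILIARY-FUNCTION unit cuts (`CT26al`: `|P_1| ≤ 3`, `|P_2| ≤ 4`, `|P_3| ≤ 5`, `|P_4| ≤ 6`, `|P_5| ≤ 9`, `-7 ≤ P_6 ≤ 8`, `|P_7| ≤ 10`,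
`-10 ≤ P_8 ≤ 11`, `|P_9| ≤ 17`, `|P_10| ≤ 13`, `|P_11| ≤ 19`, `-14 ≤ P_12 ≤ 20`, `|P_13| ≤ 22`; files `AuxCut26L…`/`K…`/`N12PosS…`, all
certified at `20/17`) — and EXTENDED leaf thresholds (`ThresholdsValidX`, mahler g15) from the certified unit cuts at `k ∈ [15, 17, 18, 20]`;
the KERNEL evaluates the packed form `censusSearchPs` (mahler g20) in the 360 parts `CensusKernelDeg26P…` and transfers by
`forall_certX_of_allCertifiedPs`.  The bound is the LEHMER bound `B = 20/17 = 1.17647… > 1.17629 > M(ℓ)`: the row is EMPTY up to the `exc`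
certificates of listed cores (all `M > 1.1883`, `coresDeg26_gap`).  The search has 4626568 leaves with `c_1 ≥ 0`; 120525 small-cyclotomic
survivors are dropped in the kernel and 39903 survivors are discharged by EXTENDED certificates `CertX` (`base (red/cyc/exc)` or the
trace–Graeffe rejection `tgr m k`); the exception list is the full 61-entry list `coresDeg26`, up to `x ↦ -x`.  Tables: `CensusKernelDeg26Tables`.

PART B (assembly).  The node lemmas of the subtree files `CensusKernelDeg26S01–S18` (which import the parts directly) give `certified26`
(every survivor with `c₁ ≥ 0` carries a valid certificate) and `degreeCensus_twentysix : DegreeCensus 26 (20/17) coresDeg26` by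
`degreeCensus_of_certified_nonnegXC` (`x ↦ -x` symmetry); corollaries at the LEHMER bound:
* `degreeCensus_twentysix_lehmer : DegreeCensus 26 (20/17) []` — the row is EMPTY;
* `lehmer_le_of_irreducible_degree_twentysix` — an irreducible `P ∈ ℤ[X]` of degree 26 with `M(P) > 1` has `M(P) ≥ 20/17 > M(ℓ)`;
* `lehmer_le_of_irreducible_of_natDegree_twentysix_or_twentyseven` — the same for irreducible `P` of degree 26 or 27 (odd degree or a
  non-reciprocal `P` has `M(P) ≥ θ₀ > 20/17` by Smyth's theorem, `reciprocal_of_measure_lt_smythTheta`).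
These do NOT depend on the degree-24 census; 'Lehmer's bound for every `P` of degree `≤ 27`' is `SubLehmerDegreeTwentyEight`
(needs `SubLehmerDegreeTwentySix`).  MRW08's row `D = 26` (`M_26 = 1.2237…`) would need `B ≈ 1.23`, out of reach of the kernel.
CONTROL/replication (Lehmer's bound at degree 26; print complete to degree 44: Boyd 1980/1989, Mossinghoff 1998, Flammang–Rhin–Sac-Épée 2006,
Mossinghoff–Rhin–Wu 2008), not new ground.
-/

namespace Summit.Ventures.DiscreteObjects.Mahler

open Polynomial

/-- **The certified cut** `0 ≤ 14 + Σ_k a_k P_k` (`a = [0, 0, 0, 0, 0, 0, 0, 0, 0, 0, 0, 1]`, i.e. `+P_12 ≥ -14`) for irreducible reciprocal `P` of degree `26`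
with `M(P) < 20/17` — composed from the 50 + 6 independent segment checks of the star package `AuxCut26N12PosS…` (mahler g21). -/
theorem AuxCut26N12Pos.cutValid : CutValidAL 13 12 ((((20/17) : ℚ)) : ℝ) ([1, 0, 0, 0, 0, 0, 0, 0, 0, 0, 0, 0], 14) :=
  cutValidAL_of_claims (d := 13) (a := [0, 0, 0, 0, 0, 0, 0, 0, 0, 0, 0, 1]) (κ := 2064032) (s1 := -1) (s2 := 0) (by decide +kernel)
    (circleClaim_of_segClaim (segClaim_append (segClaim_of_segCheck AuxCut26N12Pos.c1s0) (segClaim_append (segClaim_of_segCheck AuxCut26N12Pos.c1s1) (segClaim_append (segClaim_of_segCheck AuxCut26N12Pos.c1s2) (segClaim_append (segClaim_of_segCheck AuxCut26N12Pos.c1s3) (segClaim_append (segClaim_of_segCheck AuxCut26N12Pos.c1s4) (segClaim_append (segClaim_of_segCheck AuxCut26N12Pos.c1s5) (segClaim_append (segClaim_of_segCheck AuxCut26N12Pos.c1s6) (segClaim_append (segClaim_of_segCheck AuxCut26N12Pos.c1s7) (segClaim_append (segClaim_of_segCheck AuxCut26N12Pos.c1s8) (segClaim_append (segClaim_of_segCheck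 AuxCut26N12Pos.c1s9) (segClaim_append (segClaim_of_segCheck AuxCut26N12Pos.c1s10) (segClaim_append (segClaim_of_segCheck AuxCut26N12Pos.c1s11) (segClaim_append (segClaim_of_segCheck AuxCut26N12Pos.c1s12) (segClaim_append (segClaim_of_segCheck AuxCut26N12Pos.c1s13) (segClaim_append (segClaim_of_segCheck AuxCut26N12Pos.c1s14) (segClaim_append (segClaim_of_segCheck AuxCut26N12Pos.c1s15) (segClaim_append (segClaim_of_segCheck AuxCut26N12Pos.c1s16) (segClaim_append (segClaim_of_segCheck AuxCut26N12Pos.c1s17) (segClaim_append (segClaim_of_segCheck AuxCut26N12Pos.c1s18) (segClaim_append (segClaim_of_segCheck AuxCut26N12Pos.c1s19) (segClaim_append (segClaim_of_segCheck AuxCut26N12Pos.c1s20) (segClaim_append (segClaim_of_segCheck AuxCut26N12Pos.c1s21) (segClaim_append (segClaim_of_segCheck AuxCut26N12Pos.c1s22) (segClaim_append (segClaim_of_segCheck AuxCut26N12Pos.c1s23) (segClaim_append (segClaim_of_segCheck AuxCut26N12Pos.c1s24) (segClaim_append (segClaim_of_segCheck AuxCut26N12Pos.c1s25) (segClaim_append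 (segClaim_of_segCheck AuxCut26N12Pos.c1s26) (segClaim_append (segClaim_of_segCheck AuxCut26N12Pos.c1s27) (segClaim_append (segClaim_of_segCheck AuxCut26N12Pos.c1s28) (segClaim_append (segClaim_of_segCheck AuxCut26N12Pos.c1s29) (segClaim_append (segClaim_of_segCheck AuxCut26N12Pos.c1s30) (segClaim_append (segClaim_of_segCheck AuxCut26N12Pos.c1s31) (segClaim_append (segClaim_of_segCheck AuxCut26N12Pos.c1s32) (segClaim_append (segClaim_of_segCheck AuxCut26N12Pos.c1s33) (segClaim_append (segClaim_of_segCheck AuxCut26N12Pos.c1s34) (segClaim_append (segClaim_of_segCheck AuxCut26N12Pos.c1s35) (segClaim_append (segClaim_of_segCheck AuxCut26N12Pos.c1s36) (segClaim_append (segClaim_of_segCheck AuxCut26N12Pos.c1s37) (segClaim_append (segClaim_of_segCheck AuxCut26N12Pos.c1s38) (segClaim_append (segClaim_of_segCheck AuxCut26N12Pos.c1s39) (segClaim_append (segClaim_of_segCheck AuxCut26N12Pos.c1s40) (segClaim_append (segClaim_of_segCheck AuxCut26N12Pos.c1s41) (segClaim_append (segClaim_of_segCheck AuxCut26N12Pos.c1s42)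 (segClaim_append (segClaim_of_segCheck AuxCut26N12Pos.c1s43) (segClaim_append (segClaim_of_segCheck AuxCut26N12Pos.c1s44) (segClaim_append (segClaim_of_segCheck AuxCut26N12Pos.c1s45) (segClaim_append (segClaim_of_segCheck AuxCut26N12Pos.c1s46) (segClaim_append (segClaim_of_segCheck AuxCut26N12Pos.c1s47) (segClaim_append (segClaim_of_segCheck AuxCut26N12Pos.c1s48) (segClaim_of_segCheck AuxCut26N12Pos.c1s49)))))))))))))))))))))))))))))))))))))))))))))))))))
    (circleClaim_of_segClaim (segClaim_append (segClaim_of_segCheck AuxCut26N12Pos.cBs0) (segClaim_append (segClaim_of_segCheck AuxCut26N12Pos.cBs1) (segClaim_append (segClaim_of_segCheck AuxCut26N12Pos.cBs2) (segClaim_append (segClaim_of_segCheck AuxCut26N12Pos.cBs3) (segClaim_append (segClaim_of_segCheck AuxCut26N12Pos.cBs4) (segClaim_of_segCheck AuxCut26N12Pos.cBs5)))))))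

/-- **The thresholds are valid in the extended sense** for `B = 20/17`: elementary bound `T_k = ceil(2d-2+B^k+B^-k)-1` except for
`k ∈ [15, 17, 18, 20]`, where `T_k = max(N⁺, N⁻)` comes from the certified unit cuts `±P_k ≥ -N^±` (`AuxCut26L<k>Pos/Neg`). -/
theorem thresholdsValidX_T26 : ThresholdsValidX 13 (((20 : ℕ) : ℝ) / ((17 : ℕ) : ℝ)) T26 := by
  intro k hk1 hk2
  have hk : k ≤ 30 := hk2
  interval_cases k
  · left; norm_num [T26]
  · left; norm_num [T26]
  · left; norm_num [T26]
  · left; norm_num [T26]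
  · left; norm_num [T26]
  · left; norm_num [T26]
  · left; norm_num [T26]
  · left; norm_num [T26]
  · left; norm_num [T26]
  · left; norm_num [T26]
  · left; norm_num [T26]
  · left; norm_num [T26]
  · left; norm_num [T26]
  · left; norm_num [T26]
  · right
    rw [← ratCast_B24]
    exact ⟨25, 25, by norm_num [T26], by norm_num [T26], AuxCut26L15Pos.cutValid, AuxCut26L15Neg.cutValid⟩
  · left; norm_num [T26]
  · right
    rw [← ratCast_B24]
    exact ⟨30, 30, by norm_num [T26], by norm_num [T26], AuxCut26L17Pos.cutValid, AuxCut26L17Neg.cutValid⟩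
  · right
    rw [← ratCast_B24]
    exact ⟨33, 33, by norm_num [T26], by norm_num [T26], AuxCut26L18Pos.cutValid, AuxCut26L18Neg.cutValid⟩
  · left; norm_num [T26]
  · right
    rw [← ratCast_B24]
    exact ⟨37, 40, by norm_num [T26], by norm_num [T26], AuxCut26L20Pos.cutValid, AuxCut26L20Neg.cutValid⟩
  · left; norm_num [T26]
  · left; norm_num [T26]
  · left; norm_num [T26]
  · left; norm_num [T26]
  · left; norm_num [T26]
  · left; norm_num [T26]
  · left; norm_num [T26]
  · left; norm_num [T26]
  · left; norm_num [T26]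
  · left; norm_num [T26]

/-- Every certified auxiliary cut of the search table is valid for `(d, B) = (13, 20/17)` (one certificate file each,
`AuxCut26L…`, certified at `20/17` by this seat). -/
theorem cutTableValidAL_CT26al : CutTableValidAL 13 (((20 : ℕ) : ℝ) / ((17 : ℕ) : ℝ)) CT26al := by
  rw [← ratCast_B24]
  intro k hk1 hk2 c hc
  have hk : k ≤ 13 := hk2
  interval_cases k
  · simp [CT26al] at hc
    rcases hc with rfl | rfl
    · exact AuxCut26L1Pos.cutValid
    · exact AuxCut26L1Neg.cutValid
  · simp [CT26al] at hc
    rcases hc with rfl | rfl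
    · exact AuxCut26L2Pos.cutValid
    · exact AuxCut26K2Neg.cutValid
  · simp [CT26al] at hc
    rcases hc with rfl | rfl
    · exact AuxCut26L3Pos.cutValid
    · exact AuxCut26L3Neg.cutValid
  · simp [CT26al] at hc
    rcases hc with rfl | rfl
    · exact AuxCut26L4Pos.cutValid
    · exact AuxCut26L4Neg.cutValid
  · simp [CT26al] at hc
    rcases hc with rfl | rfl
    · exact AuxCut26L5Pos.cutValid
    · exact AuxCut26L5Neg.cutValid
  · simp [CT26al] at hc
    rcases hc with rfl | rfl
    · exact AuxCut26L6Pos.cutValid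
    · exact AuxCut26L6Neg.cutValid
  · simp [CT26al] at hc
    rcases hc with rfl | rfl
    · exact AuxCut26L7Pos.cutValid
    · exact AuxCut26L7Neg.cutValid
  · simp [CT26al] at hc
    rcases hc with rfl | rfl
    · exact AuxCut26L8Pos.cutValid
    · exact AuxCut26L8Neg.cutValid
  · simp [CT26al] at hc
    rcases hc with rfl | rfl
    · exact AuxCut26L9Pos.cutValid
    · exact AuxCut26L9Neg.cutValid
  · simp [CT26al] at hc
    rcases hc with rfl | rfl
    · exact AuxCut26L10Pos.cutValid
    · exact AuxCut26L10Neg.cutValid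
  · simp [CT26al] at hc
    rcases hc with rfl | rfl
    · exact AuxCut26L11Pos.cutValid
    · exact AuxCut26L11Neg.cutValid
  · simp [CT26al] at hc
    rcases hc with rfl | rfl
    · exact AuxCut26N12Pos.cutValid
    · exact AuxCut26L12Neg.cutValid
  · simp [CT26al] at hc
    rcases hc with rfl | rfl
    · exact AuxCut26L13Pos.cutValid
    · exact AuxCut26L13Neg.cutValid

/-- **Every cut of the combined table `CT26` is valid** for `(d, B) = (13, 20/17)`. -/
theorem cutTableValidX_CT26 : CutTableValidX 13 (((20 : ℕ) : ℝ) / ((17 : ℕ) : ℝ)) CT26 := by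
  rw [← CT26_eq_merge]
  exact cutTableValidX_merge (cutTableValidTR_of_check cutTableCheckTR_CT26tr) cutTableValidAL_CT26al

open Literature.NumberTheory.MahlerMeasure

/-- Every survivor with `c₁ ≥ 0` of the degree-26 search (with cuts) is certified. -/
theorem certified26 : ∀ a ∈ censusSearchC T26 CT26 13 [] [], 0 ≤ a.getD 0 0 →
    ∃ c, checkCertX 20 17 13 coresDeg26 LC26 (1 :: palC a) c = true := by
  intro a ha hsign
  rw [show censusSearchC T26 CT26 13 [] [] = censusSearchC T26 CT26 13 [] (psumsRev [] 0) from rfl,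
    mem_censusSearchC_node_iff (pre := []) (n := 0) rfl, (by decide +kernel : nodeLoC T26 CT26 [] (psumsRev [] 0) = -3),
    (by decide +kernel : nodeHiC T26 CT26 [] (psumsRev [] 0) = 3)] at ha
  obtain ⟨a1, ha1, ha⟩ := ha
  simp only [List.nil_append, Nat.reduceAdd] at ha
  rw [getD_zero_of_mem_censusSearchC_cons ha] at hsign
  rw [mem_icc] at ha1
  obtain ⟨hlo1, hhi1⟩ := ha1
  interval_cases a1
  · rw [mem_censusSearchC_node_iff (pre := [0]) (n := 1) rfl,
      (by decide +kernel : nodeLoC T26 CT26 [0] (psumsRev [0] 1) = -2),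
      (by decide +kernel : nodeHiC T26 CT26 [0] (psumsRev [0] 1) = 2)] at ha
    obtain ⟨a2, ha2, ha⟩ := ha
    simp only [List.cons_append, List.nil_append, Nat.reduceAdd] at ha
    rw [mem_icc] at ha2
    obtain ⟨hlo2, hhi2⟩ := ha2
    interval_cases a2
    · exact certified26n_p0_m2 a ha
    · exact certified26n_p0_m1 a ha
    · exact certified26n_p0_p0 a ha
    · exact certified26n_p0_p1 a ha
    · exact certified26n_p0_p2 a ha
  · rw [mem_censusSearchC_node_iff (pre := [1]) (n := 1) rfl,
      (by decide +kernel : nodeLoC T26 CT26 [1] (psumsRev [1] 1) = -1),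
      (by decide +kernel : nodeHiC T26 CT26 [1] (psumsRev [1] 1) = 2)] at ha
    obtain ⟨a2, ha2, ha⟩ := ha
    simp only [List.cons_append, List.nil_append, Nat.reduceAdd] at ha
    rw [mem_icc] at ha2
    obtain ⟨hlo2, hhi2⟩ := ha2
    interval_cases a2
    · exact certified26n_p1_m1 a ha
    · exact certified26n_p1_p0 a ha
    · exact certified26n_p1_p1 a ha
    · exact certified26n_p1_p2 a ha
  · rw [mem_censusSearchC_node_iff (pre := [2]) (n := 1) rfl,
      (by decide +kernel : nodeLoC T26 CT26 [2] (psumsRev [2] 1) = 0),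
      (by decide +kernel : nodeHiC T26 CT26 [2] (psumsRev [2] 1) = 4)] at ha
    obtain ⟨a2, ha2, ha⟩ := ha
    simp only [List.cons_append, List.nil_append, Nat.reduceAdd] at ha
    rw [mem_icc] at ha2
    obtain ⟨hlo2, hhi2⟩ := ha2
    interval_cases a2
    · exact certified26n_p2_p0 a ha
    · exact certified26n_p2_p1 a ha
    · exact certified26n_p2_p2 a ha
    · exact certified26n_p2_p3 a ha
    · exact certified26n_p2_p4 a ha
  · rw [mem_censusSearchC_node_iff (pre := [3]) (n := 1) rfl,
      (by decide +kernel : nodeLoC T26 CT26 [3] (psumsRev [3] 1) = 3),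
      (by decide +kernel : nodeHiC T26 CT26 [3] (psumsRev [3] 1) = 6)] at ha
    obtain ⟨a2, ha2, ha⟩ := ha
    simp only [List.cons_append, List.nil_append, Nat.reduceAdd] at ha
    rw [mem_icc] at ha2
    obtain ⟨hlo2, hhi2⟩ := ha2
    interval_cases a2
    · exact certified26n_p3_p3 a ha
    · exact certified26n_p3_p4 a ha
    · exact certified26n_p3_p5 a ha
    · exact certified26n_p3_p6 a ha

/-- **Degree-26 census below `20/17` (kernel theorem):** `DegreeCensus 26 (20/17) coresDeg26` — every irreducible
`P ∈ ℤ[X]` of degree `26` with `1 < M(P) < 20/17` is `± c(± x)` for one of the 61 listed census cores of `coresDeg26`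
(none of which lies below `20/17`: all have `M > 1.1883`, `coresDeg26_gap`), i.e. NO irreducible integer polynomial of degree 26
has `1 < M < 20/17` — Lehmer's bound at degree 26, inside the kernel; CONTROL/replication row (print complete to degree 44). -/
theorem degreeCensus_twentysix : DegreeCensus 26 (20 / 17) coresDeg26 := by
  have h := degreeCensus_of_certified_nonnegXC (Bn := 20) (Bd := 17) (d := 13) (by norm_num) (by norm_num) (by norm_num)
    (by decide) thresholdsValidX_T26 cutTableValidX_CT26 leafCutsValid_LC26 (by have := smythTheta_gt; push_cast; linarith)
    certified26
  norm_num at h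
  exact h

/-- **Degree-26 census below the Lehmer bound `20/17`, tight form: the list is EMPTY** — no irreducible `P ∈ ℤ[X]` of
degree `26` has `1 < M(P) < 20/17` (the 61 listed cores all have `M > 1.1883 > 20/17` by their kernel enclosures, `coresDeg26_gap`). -/
theorem degreeCensus_twentysix_lehmer : DegreeCensus 26 (20 / 17) [] := by
  intro p hdeg hirr h1 hB
  obtain ⟨l, hl, hform⟩ := degreeCensus_twentysix p hdeg hirr h1 hB
  have hM := intMahlerMeasure_of_census_form hform
  have hgap := coresDeg26_gap l hl
  rw [hM] at hB
  exfalso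
  linarith

/-- An irreducible `P` of degree `26` with `M(P) > 1` has `M(P) ≥ M(ℓ)` (in fact `M(P) ≥ 20/17 > M(ℓ)`). -/
theorem lehmer_le_of_irreducible_degree_twentysix {P : ℤ[X]} (hirr : Irreducible P) (hdeg : P.natDegree = 26)
    (h1 : 1 < intMahlerMeasure P) : intMahlerMeasure lehmerPoly ≤ intMahlerMeasure P := by
  have hL : intMahlerMeasure lehmerPoly < 20 / 17 := lt_trans lehmer_measure_upper_bound (by norm_num)
  by_cases h : intMahlerMeasure P < 20 / 17
  · obtain ⟨l, hl, -⟩ := degreeCensus_twentysix_lehmer P hdeg hirr h1 h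
    simp at hl
  · push Not at h
    exact le_trans (le_of_lt hL) h

/-- **Irreducible polynomials of degree `26` or `27` satisfy Lehmer's bound** (degree 27, or a non-reciprocal `P`, by Smyth's
theorem; reciprocal degree 26 by the kernel census). -/
theorem lehmer_le_of_irreducible_of_natDegree_twentysix_or_twentyseven {P : ℤ[X]} (hirr : Irreducible P)
    (h26 : 26 ≤ P.natDegree) (h27 : P.natDegree ≤ 27) (h1 : 1 < intMahlerMeasure P) :
    intMahlerMeasure lehmerPoly ≤ intMahlerMeasure P := by
  by_cases hB : 20 / 17 ≤ intMahlerMeasure P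
  · exact le_trans (le_of_lt (lt_trans lehmer_measure_upper_bound (by norm_num))) hB
  push Not at hB
  have hθ : intMahlerMeasure P < smythTheta := lt_trans hB (lt_trans (by norm_num) smythTheta_gt)
  obtain ⟨-, ⟨j, hj⟩, -⟩ := reciprocal_of_measure_lt_smythTheta hirr h1 hθ
  have hd : P.natDegree = 26 := by omega
  exact lehmer_le_of_irreducible_degree_twentysix hirr hd h1

end Summit.Ventures.DiscreteObjects.Mahler
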